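import Summits.Ventures.PercRepro.Night2ShapeOneMainA
import Summits.Ventures.PercRepro.Night2ShapeOneSidePack
import Summits.Ventures.PercRepro.Night2ShapeOneCounts

/-!
# PercRepro — the seven-point shape (i): the assembly, part B — lemmas (night-2, gen 30)

`mem_clF_base_of_two_faces_S`: an outside point in two face closures `cl (insert y₁ P)`, `cl (insert y₂ P)` of a side
(`P` the base, rank `4`; the two faces span `S ∖ y₃`, rank `6`) is in `cl P`.  `two_le_mH_of_source`: a source on a
line has a thin face at `w`, so `|G ∖ cl (S ∖ w)| ≥ 2`.  `face_identities`: the faces of the erasures of a line as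
insertions into the base.  These feed the assembly Night2ShapeOneMainC (proofs/NIGHT-2-g30.md §5).
-/

namespace PercRepro.Shadow

open Finset PerFlat ThmH

variable {α : Type*} [DecidableEq α] {M : Matroid α} [M.Finite] {G : Finset α}

section MainB

/-- **Two faces of a side meet in the base** (rank form): `X, Y ⊇ P` of rank `≤ 5` with `rk (X ∪ Y) ≥ 6` and
`rk P = 4`; a point of `cl X ∩ cl Y` is in `cl P`. -/
theorem mem_clF_of_mem_two_clF {X Y P : Finset α} (hX : X ⊆ gr M) (hY : Y ⊆ gr M) (hXr : rkN M X ≤ 5)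
    (hYr : rkN M Y ≤ 5) (hU : 6 ≤ rkN M (X ∪ Y)) (hPX : P ⊆ X) (hPY : P ⊆ Y) (hP4 : rkN M P = 4) {x : α}
    (hxg : x ∈ gr M) (hx₁ : x ∈ clF M X) (hx₂ : x ∈ clF M Y) : x ∈ clF M P := by
  have hsub := rkN_inter_clF_add_le (M := M) hX hY
  have hmem : insert x P ⊆ clF M X ∩ clF M Y := by
    intro a ha
    rw [Finset.mem_inter]
    rw [Finset.mem_insert] at ha
    rcases ha with h | h
    · rw [h]; exact ⟨hx₁, hx₂⟩
    · exact ⟨subset_clF_of_subset_gr hX (hPX h), subset_clF_of_subset_gr hY (hPY h)⟩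
  have hle : rkN M (insert x P) ≤ 4 := by
    have := rkN_mono (M := M) hmem
    omega
  have hPg : P ⊆ gr M := hPX.trans hX
  apply mem_clF_of_rkN_eq (Finset.subset_insert _ _) (Finset.insert_subset hxg hPg) _ (Finset.mem_insert_self _ _)
  have := rkN_mono (M := M) (Finset.subset_insert x P)
  omega

/-- A point of a collinear triple is in the closure of the other two (rank `2`, simple). -/
theorem mem_clF_erase_of_line (hs : ∀ e ∈ gr M, ∀ f ∈ gr M, e ≠ f → rkN M {e, f} = 2) {R : Finset α}
    (hRg : R ⊆ gr M) (h3 : R.card = 3) (hr : rkN M R = 2) {y : α} (hy : y ∈ R) : y ∈ clF M (R.erase y) := by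
  obtain ⟨a, b, hab, hR'⟩ := Finset.card_eq_two.1 (show (R.erase y).card = 2 by rw [Finset.card_erase_of_mem hy, h3])
  have haR : a ∈ R := (Finset.erase_subset _ _) (by rw [hR']; simp)
  have hbR : b ∈ R := (Finset.erase_subset _ _) (by rw [hR']; simp)
  have h2 : rkN M (R.erase y) = 2 := by rw [hR']; exact hs a (hRg haR) b (hRg hbR) hab
  exact mem_clF_of_rkN_eq (Finset.erase_subset _ _) hRg (by rw [h2, hr]) hy

/-- The erasure of a line point has rank `6` (`rk S = 6`): the point is in the closure of the other two. -/
theorem rkN_erase_line_point_eq_six (hG : G ∈ flatsQ M (5 + 1)) (hk : kColoops M G = 1)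
    (hs : ∀ e ∈ gr M, ∀ f ∈ gr M, e ≠ f → rkN M {e, f} = 2) {S : Finset α} (hSG : S ⊆ G) (hKS : coloops M G ⊆ S)
    (hV5 : rkN M (S \ coloops M G) = 5) {R : Finset α} (hR : R ⊆ S \ coloops M G) (h3 : R.card = 3)
    (hr : rkN M R = 2) {y : α} (hy : y ∈ R) : rkN M (S.erase y) = 6 := by
  have hGg : G ⊆ gr M := (mem_flatsQ.1 hG).1
  have hSg : S ⊆ gr M := hSG.trans hGg
  have hRS : R ⊆ S := fun a ha => (Finset.mem_sdiff.1 (hR ha)).1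
  have hS6 := rkN_S_eq_six hG hk hSG hKS hV5
  have hycl : y ∈ clF M (S.erase y) := clF_mono (Finset.erase_subset_erase _ hRS)
    (mem_clF_erase_of_line hs (hRS.trans hSg) h3 hr hy)
  have hyc : y ∉ coloops M S := fun h => (mem_coloops.1 h).2 hycl
  rw [rkN_erase_of_not_coloop hSg (hRS hy) hyc, hS6]

/-- **A source on a line has a thin face at `w`**, so `|G ∖ cl (S ∖ w)| ≥ 2`. -/
theorem two_le_mH_of_source (hG : G ∈ flatsQ M (5 + 1)) (hd : (gr M \ G).card = 2) (hk : kColoops M G = 1)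
    (hs : ∀ e ∈ gr M, ∀ f ∈ gr M, e ≠ f → rkN M {e, f} = 2) (hl : ∀ e ∈ gr M, M.Indep {e}) {S : Finset α}
    (hSG : S ⊆ G) (hV5 : rkN M (S \ coloops M G) = 5) {w : α} (hc : coloops M (S \ coloops M G) = {w})
    {y₁ y₂ y₃ : α} (hy₁V : y₁ ∈ S \ coloops M G) (hy₁c : y₁ ∉ coloops M (S \ coloops M G))
    (hcol₂ : y₂ ∈ coloops M ((S \ coloops M G).erase y₁)) (hcol₃ : y₃ ∈ coloops M ((S \ coloops M G).erase y₁))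
    (hwy₂ : w ≠ y₂) (hwy₃ : w ≠ y₃) (h23 : y₂ ≠ y₃) {w' : α} (hw' : w' ∈ S.erase y₁)
    (h0 : faceLossP M 5 G (bigP M G) (S.erase y₁) w' ≠ 0) : 2 ≤ (G \ clF M (S.erase w)).card := by
  have hd' : (gr M \ G).card ≤ 5 := by omega
  have hwc : w ∈ coloops M (S \ coloops M G) := by rw [hc]; exact Finset.mem_singleton_self _
  have hy₁w : y₁ ≠ w := fun h => hy₁c (h ▸ hwc)
  have hQ₁V : S.erase y₁ \ coloops M G = (S \ coloops M G).erase y₁ := by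
    ext a; simp only [Finset.mem_sdiff, Finset.mem_erase]; tauto
  have hC₁ : coloops M (S.erase y₁ \ coloops M G) = {w, y₂, y₃} :=
    coloops_eq_triple (lossy_structure_of_faceLossP_ne_zero hG hd hk hs hl hw' h0).2.2.1
      (by rw [hQ₁V]; exact mem_coloops_erase_of_mem_coloops hwc hy₁w.symm) (by rw [hQ₁V]; exact hcol₂)
      (by rw [hQ₁V]; exact hcol₃) hwy₂ hwy₃ h23
  obtain ⟨hthinw, -, -⟩ := faces_thin_of_triple hG hd hk hs hl hw' h0 hC₁
  have := two_le_card_sdiff_of_not_lay0 hG hd' (mem_thinMembers.1 hthinw).1 (mem_thinMembers.1 hthinw).2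
  rw [clF_face_coloop_eq hG hSG hV5 hwc hy₁V hy₁w hy₁c] at this
  exact this

/-- The triple erasure is the difference with the triple. -/
theorem erase_three_eq_sdiff (S : Finset α) (y₁ y₂ y₃ : α) :
    ((S.erase y₁).erase y₂).erase y₃ = S \ {y₁, y₂, y₃} := by
  ext a; simp only [Finset.mem_erase, Finset.mem_sdiff, Finset.mem_insert, Finset.mem_singleton]; tauto

/-- **Two faces of a line meet in the base** (`S`-level): for the collinear triple `R = {y₁, y₂, y₃}` of a shape-(i)
target and the base `P = S ∖ R` (rank `4`), a point of `cl (insert y₁ P) ∩ cl (insert y₂ P)` is in `cl P`: the two faces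
span `S ∖ y₃`, of rank `6`. -/
theorem mem_clF_sdiff_of_two_faces (hG : G ∈ flatsQ M (5 + 1)) (hk : kColoops M G = 1)
    (hs : ∀ e ∈ gr M, ∀ f ∈ gr M, e ≠ f → rkN M {e, f} = 2) {S : Finset α} (hSG : S ⊆ G) (hKS : coloops M G ⊆ S)
    (hV5 : rkN M (S \ coloops M G) = 5) {R : Finset α} (hR : R ⊆ S \ coloops M G) (h3 : R.card = 3)
    (hr : rkN M R = 2) {y₁ y₂ y₃ : α} (hRe : R = {y₁, y₂, y₃}) {P : Finset α} (hP : P = S \ R)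
    (hP4 : rkN M P = 4) {x : α} (hxG : x ∈ G) (h1 : x ∈ clF M (insert y₁ P)) (h2 : x ∈ clF M (insert y₂ P)) :
    x ∈ clF M P := by
  have hGg : G ⊆ gr M := (mem_flatsQ.1 hG).1
  have hSg : S ⊆ gr M := hSG.trans hGg
  have hRS : R ⊆ S := fun a ha => (Finset.mem_sdiff.1 (hR ha)).1
  have hPg : P ⊆ gr M := by rw [hP]; exact Finset.sdiff_subset.trans hSg
  have hy₁S : y₁ ∈ S := hRS (by rw [hRe]; simp)
  have hy₂S : y₂ ∈ S := hRS (by rw [hRe]; simp)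
  have hy₃R : y₃ ∈ R := by rw [hRe]; simp
  have hface : ∀ y ∈ S, rkN M (insert y P) ≤ 5 := by
    intro y _
    have := rkN_union_le_rkN_add_card (M := M) P {y}
    rw [Finset.card_singleton, hP4] at this
    rw [Finset.insert_eq, Finset.union_comm]; exact this
  have hU : 6 ≤ rkN M (insert y₁ P ∪ insert y₂ P) := by
    have h6 := rkN_erase_line_point_eq_six hG hk hs hSG hKS hV5 hR h3 hr hy₃R
    have hsub : S.erase y₃ ⊆ insert y₁ P ∪ insert y₂ P := by
      intro y hy
      rw [Finset.mem_erase] at hy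
      rw [Finset.mem_union, Finset.mem_insert, Finset.mem_insert, hP, Finset.mem_sdiff, hRe]
      simp only [Finset.mem_insert, Finset.mem_singleton]
      by_cases hy1 : y = y₁
      · exact Or.inl (Or.inl hy1)
      by_cases hy2 : y = y₂
      · exact Or.inr (Or.inl hy2)
      exact Or.inl (Or.inr ⟨hy.2, by push Not; exact ⟨hy1, hy2, hy.1⟩⟩)
    have := rkN_mono (M := M) hsub
    omega
  exact mem_clF_of_mem_two_clF (Finset.insert_subset (hSg hy₁S) hPg) (Finset.insert_subset (hSg hy₂S) hPg)
    (hface y₁ hy₁S) (hface y₂ hy₂S) hU (Finset.subset_insert _ _) (Finset.subset_insert _ _) hP4 (hGg hxG) h1 h2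

open scoped Classical in
/-- **The request `r_H` of the target**: `Φ/(m_H + 2)` if some `H`-type face (of `S` or of an erasure of a line
point) is a thin member, else `0`; it equals the request of every thin `H`-face of a source, bounds `L1 S`, certifies the
fat closure `H` when it is `7/24`, and is admissible for `m_H`. -/
theorem rH_of_shape (hG : G ∈ flatsQ M (5 + 1)) (hd : (gr M \ G).card = 2) {S : Finset α} (hSG : S ⊆ G)
    {w : α} (hc : coloops M (S \ coloops M G) = {w}) (hV5 : rkN M (S \ coloops M G) = 5) {R₁ R₂ : Finset α}
    (hV : S \ coloops M G = insert w (R₁ ∪ R₂)) (hw₁ : w ∉ R₁) (hw₂ : w ∉ R₂) :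
    ∃ rH : ℚ, (∀ y ∈ S \ coloops M G, y ≠ w → y ∉ coloops M (S \ coloops M G) → y ∈ R₁ ∪ R₂ →
        (S.erase y).erase w ∈ thinMembers M 5 G → req M 5 ((S.erase y).erase w) = rH) ∧
      L1 M 5 G S ≤ rH ∧ (rH = 7 / 24 → clF M (S.erase w) ∈ fatClosures M 5 G 2) ∧ 0 ≤ rH ∧
      ((G \ clF M (S.erase w)).card = 2 → rH = 0 ∨ rH = 7 / 24) ∧
      (3 ≤ (G \ clF M (S.erase w)).card → rH ≤ rhoReq (G \ clF M (S.erase w)).card) ∧ rH ≤ 7 / 12 := by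
  have hd' : (gr M \ G).card ≤ 5 := by omega
  have hφ : (0 : ℚ) ≤ phiQ 5 := by unfold phiQ; norm_num
  have hmHnn : (0 : ℚ) < ((G \ clF M (S.erase w)).card : ℚ) + 2 := by
    have := Nat.cast_nonneg (α := ℚ) (G \ clF M (S.erase w)).card
    linarith
  have hwc : w ∈ coloops M (S \ coloops M G) := by rw [hc]; exact Finset.mem_singleton_self _
  refine ⟨if (S.erase w ∈ thinMembers M 5 G ∨ ∃ y ∈ R₁ ∪ R₂, (S.erase y).erase w ∈ thinMembers M 5 G)
      then phiQ 5 / (((G \ clF M (S.erase w)).card : ℚ) + 2) else 0, ?_, ?_, ?_, ?_, ?_, ?_, ?_⟩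
  · intro y hyV hyw hyc hyR hthin
    rw [if_pos (Or.inr ⟨y, hyR, hthin⟩), req_eq_of_thin hG hthin, hd, clF_face_coloop_eq hG hSG hV5 hwc hyV hyw hyc]
    push_cast; ring
  · unfold L1
    have hsub := thin_coverPreimages_subset_image_coloops hG hd' S
    rw [hc, Finset.image_singleton] at hsub
    by_cases hthinS : S.erase w ∈ thinMembers M 5 G
    · have hle : ∑ F ∈ (coverPreimages M (Uq M (5 + 2) 5) G S).filter (fun F => F ∉ lay0 M 5 G), req M 5 F ≤
          ∑ F ∈ ({S.erase w} : Finset (Finset α)), req M 5 F := by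
        apply Finset.sum_le_sum_of_subset_of_nonneg hsub
        intro F _ _
        exact req_nonneg 5 F
      rw [Finset.sum_singleton, req_eq_of_thin hG hthinS, hd] at hle
      rw [if_pos (Or.inl hthinS)]
      push_cast at hle ⊢
      linarith
    · have hempty : (coverPreimages M (Uq M (5 + 2) 5) G S).filter (fun F => F ∉ lay0 M 5 G) = ∅ := by
        rw [Finset.eq_empty_iff_forall_notMem]
        intro F hF
        have hF' := hsub hF
        rw [Finset.mem_singleton] at hF'
        rw [Finset.mem_filter, mem_coverPreimages] at hF
        exact hthinS (hF' ▸ mem_thinMembers.2 ⟨hF.1.1, hF.2⟩)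
      rw [hempty, Finset.sum_empty]
      split_ifs
      · exact div_nonneg hφ hmHnn.le
      · exact le_refl _
  · intro hr
    by_cases hcond : (S.erase w ∈ thinMembers M 5 G ∨ ∃ y ∈ R₁ ∪ R₂, (S.erase y).erase w ∈ thinMembers M 5 G)
    · rw [if_pos hcond] at hr
      have hm2 : (G \ clF M (S.erase w)).card = 2 := by
        have hr' := hr
        unfold phiQ at hr'
        rw [div_eq_iff (by positivity)] at hr'
        have : ((G \ clF M (S.erase w)).card : ℚ) = 2 := by linarith
        exact_mod_cast this
      rcases hcond with h | ⟨y, hyR, h⟩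
      · unfold fatClosures; rw [Finset.mem_image]; exact ⟨S.erase w, Finset.mem_filter.2 ⟨h, by rw [hm2]⟩, rfl⟩
      · have hyV : y ∈ S \ coloops M G := by rw [hV]; exact Finset.mem_insert_of_mem hyR
        have hyw : y ≠ w := by
          rintro rfl
          rw [Finset.mem_union] at hyR
          rcases hyR with h' | h'
          · exact hw₁ h'
          · exact hw₂ h'
        have hyc : y ∉ coloops M (S \ coloops M G) := by rw [hc, Finset.mem_singleton]; exact hyw
        unfold fatClosures
        rw [Finset.mem_image]
        refine ⟨(S.erase y).erase w, Finset.mem_filter.2 ⟨h, ?_⟩, clF_face_coloop_eq hG hSG hV5 hwc hyV hyw hyc⟩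
        rw [clF_face_coloop_eq hG hSG hV5 hwc hyV hyw hyc, hm2]
    · rw [if_neg hcond] at hr; norm_num at hr
  · split_ifs
    · exact div_nonneg hφ hmHnn.le
    · exact le_refl _
  · intro hm
    split_ifs
    · right
      rw [hm]
      unfold phiQ
      norm_num
    · left
      rfl
  · intro _
    split_ifs
    · rw [phiQ_div_eq_rhoReq]
    · exact rhoReq_nonneg _
  · split_ifs
    · unfold phiQ
      have h0 : (0 : ℚ) ≤ ((G \ clF M (S.erase w)).card : ℚ) := by positivity
      rw [div_le_iff₀ (by linarith)]; linarith
    · norm_num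

end MainB

end PercRepro.Shadow
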